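import Summits.QuantumFields.YangMills.Theorems.AllWindowsColdBoxSchurJaffardDecay

/-!
# The Schur–Jaffard block decay theorem, GRADIENT and DIPOLE forms (abstract U1b/U1c of STUB-PLAN-U1 rev 3 §7; LINE-20 ⟨stmt-QuantumFields-24336⟩)

Companion of ✓`schur_jaffard_decay` (`…AllWindowsColdBoxSchurJaffardDecay`).  For the symmetric block matrix `Q = [[A, C], [Cᵀ, K]]` on `S ⊕ R`
("skin ⊕ rest") with `K KI = 1`, skin Schur complement `M′ = A − C KI Cᵀ` and `MI = M′⁻¹`, and a SOURCE `λ = (λ_S, λ_R)`, put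
`w := λ_S − C KI λ_R` (the effective skin source).  Then EXACTLY
* `(Q⁻¹ λ)_S = MI w`, `(Q⁻¹ λ)_R = KI λ_R − KI Cᵀ MI w` (`schurInverse_mulVec_inl/inr`),
* `λᵀ Q⁻¹ λ′ = λ_Rᵀ KI λ′_R + wᵀ MI w′` (`sumElim_dotProduct_schurInverse_mulVec`).
Consequently, with the hypotheses (h2) `|KI Cᵀ| ≲ (1+d)^{−3}`, (h3) `M′` coercive with `|M′| ≲ (1+d)^{−4}` of `schur_jaffard_decay` ((h1) is NOT needed) on a skin of
growth dimension `D_S < 7/2`, and for a source anchored at `e₀` with `|λ_S|, |C KI λ_R| ≲ (1+d(·,e₀))^{−4}` on the skin and `|KI λ_R| ≲ (1+d(·,e₀))^{−3}` on the rest: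
* **`schur_jaffard_gradient_decay`** — `|(Q⁻¹ λ)(e)|·(1 + d e e₀)³ ≤ C′` (NO logarithm; only ✓`conv_three_four_le`);
* **`schur_jaffard_dipole_decay`** — for two such sources, `|λᵀ Q⁻¹ λ′|·(1 + d e₀ e₀′)⁴ ≤ C″ + |λ_Rᵀ KI λ′_R|·(1 + d e₀ e₀′)⁴` (skin growth `D_S < 4`
  suffices; the new count is `conv_same_le`, a two-region split).
Abstract forms of U1b `LandauKernelGradDecay` ((1+d)⁻³; for `λ_p = landauCoeff p` the rest part is a `ν`-difference of two deltas on a `μ`-block of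
`K^rel = ⊕_μ boxLap`, so `KI λ_R` is a lattice GRADIENT of the box Green function and `C KI λ_R`, `λ_Rᵀ KI λ′_R` are HESSIAN-type entries) and of
U1c `LandauDipoleDecay` ((1+d)⁻⁴).  Mathlib-only; no definitions; standard axioms.

HONEST LABEL: helper theorems toward the OPEN stub U1 `stub_landauKernelPackage` (⟨stmt-QuantumFields-24336⟩; also S3b/K1 bookkeeping of ⟨24004⟩/⟨24006⟩);
no stub, crux, rung or summit is proved here; the Yang–Mills mass gap is NOT proved by this file.
-/

set_option autoImplicit false

open Finset Matrix

namespace Summit.QuantumFields.YangMills.Theorems.AllWindowsColdBox.Jaffard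

universe u

/-! ## The block inverse applied to a source -/

section BlockApply

variable {S R : Type*} [Fintype S] [Fintype R]

/-- Skin component of the Schur block inverse applied to `(λ_S, λ_R)`: `MI (λ_S − C KI λ_R)`. -/
theorem schurInverse_mulVec_inl (C : Matrix S R ℝ) (KI : Matrix R R ℝ) (MI : Matrix S S ℝ) (lS : S → ℝ) (lR : R → ℝ) (s : S) :
    (Matrix.fromBlocks MI (-(MI * C * KI)) (-(KI * Cᵀ * MI)) (KI + KI * Cᵀ * MI * C * KI) *ᵥ Sum.elim lS lR) (Sum.inl s) =
      (MI *ᵥ (lS - C *ᵥ (KI *ᵥ lR))) s := by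
  rw [Matrix.fromBlocks_mulVec, Sum.elim_comp_inl, Sum.elim_comp_inr, Sum.elim_inl, Matrix.neg_mulVec, Matrix.mulVec_sub,
    Matrix.mulVec_mulVec, Matrix.mulVec_mulVec, Pi.add_apply, Pi.neg_apply, Pi.sub_apply, sub_eq_add_neg]

/-- Rest component of the Schur block inverse applied to `(λ_S, λ_R)`: `KI λ_R − KI Cᵀ MI (λ_S − C KI λ_R)`. -/
theorem schurInverse_mulVec_inr (C : Matrix S R ℝ) (KI : Matrix R R ℝ) (MI : Matrix S S ℝ) (lS : S → ℝ) (lR : R → ℝ) (r : R) :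
    (Matrix.fromBlocks MI (-(MI * C * KI)) (-(KI * Cᵀ * MI)) (KI + KI * Cᵀ * MI * C * KI) *ᵥ Sum.elim lS lR) (Sum.inr r) =
      (KI *ᵥ lR) r - ((KI * Cᵀ * MI) *ᵥ (lS - C *ᵥ (KI *ᵥ lR))) r := by
  rw [Matrix.fromBlocks_mulVec, Sum.elim_comp_inl, Sum.elim_comp_inr, Sum.elim_inr, Matrix.neg_mulVec, Matrix.mulVec_sub,
    Matrix.mulVec_mulVec, Matrix.mulVec_mulVec, Matrix.add_mulVec, Pi.add_apply, Pi.add_apply, Pi.neg_apply, Pi.sub_apply]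
  have : KI * Cᵀ * MI * C * KI = KI * Cᵀ * MI * (C * KI) := by simp only [Matrix.mul_assoc]
  rw [this]
  ring

/-- The bilinear form of the Schur block inverse between two sources: `λᵀ G λ′ = λ_Rᵀ KI λ′_R + wᵀ MI w′` with `w = λ_S − C KI λ_R`,
`w′ = λ′_S − C KI λ′_R` (needs `KI`, `MI` symmetric). -/
theorem sumElim_dotProduct_schurInverse_mulVec (C : Matrix S R ℝ) (KI : Matrix R R ℝ) (MI : Matrix S S ℝ) (hKI : KI.IsSymm)
    (hMI : MI.IsSymm) (lS lS' : S → ℝ) (lR lR' : R → ℝ) :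
    Sum.elim lS lR ⬝ᵥ (Matrix.fromBlocks MI (-(MI * C * KI)) (-(KI * Cᵀ * MI)) (KI + KI * Cᵀ * MI * C * KI) *ᵥ Sum.elim lS' lR') =
      lR ⬝ᵥ (KI *ᵥ lR') + (lS - C *ᵥ (KI *ᵥ lR)) ⬝ᵥ (MI *ᵥ (lS' - C *ᵥ (KI *ᵥ lR'))) := by
  -- rewrite the right-hand factor through the two component identities
  have hv : Matrix.fromBlocks MI (-(MI * C * KI)) (-(KI * Cᵀ * MI)) (KI + KI * Cᵀ * MI * C * KI) *ᵥ Sum.elim lS' lR' =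
      Sum.elim (MI *ᵥ (lS' - C *ᵥ (KI *ᵥ lR'))) (KI *ᵥ lR' - (KI * Cᵀ * MI) *ᵥ (lS' - C *ᵥ (KI *ᵥ lR'))) := by
    funext e
    rcases e with s | r
    · rw [schurInverse_mulVec_inl, Sum.elim_inl]
    · rw [schurInverse_mulVec_inr, Sum.elim_inr, Pi.sub_apply]
  rw [hv, sumElim_dotProduct_sumElim]
  set w' : S → ℝ := lS' - C *ᵥ (KI *ᵥ lR') with hw'
  -- `λ_R ⬝ (KI Cᵀ MI w′) = (C KI λ_R) ⬝ (MI w′)`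
  have hkey : lR ⬝ᵥ ((KI * Cᵀ * MI) *ᵥ w') = (C *ᵥ (KI *ᵥ lR)) ⬝ᵥ (MI *ᵥ w') := by
    rw [dotProduct_mulVec, dotProduct_mulVec, ← mulVec_transpose, ← mulVec_transpose, Matrix.transpose_mul,
      Matrix.transpose_mul, Matrix.transpose_transpose, hKI.eq, hMI.eq, ← mulVec_mulVec, ← mulVec_mulVec]
  rw [dotProduct_sub, hkey, sub_dotProduct]
  ring

end BlockApply

/-! ## One more skin convolution: equal exponents (two-region split) -/

section Conv

variable {S : Type*} [Fintype S]

/-- **Equal-exponent convolution over the skin**: with `d(x,y) ≤ δ₁ + δ₂` and the row sums `Σ_z (1+δᵢ z)^{−a} ≤ Tᵢ`,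
`Σ_z (1+δ₁ z)^{−a} (1+δ₂ z)^{−a} ≤ 2^a (T₁ + T₂) (1+d(x,y))^{−a}`. -/
theorem conv_same_le (δ₁ δ₂ : S → ℝ) (Dxy : ℝ) {a : ℝ} (ha : 0 ≤ a) (hδ₁ : ∀ z, 0 ≤ δ₁ z) (hδ₂ : ∀ z, 0 ≤ δ₂ z) (hD : 0 ≤ Dxy)
    (htri : ∀ z, Dxy ≤ δ₁ z + δ₂ z) {T₁ T₂ : ℝ} (hT1 : ∑ z, ((1 + δ₁ z) ^ a)⁻¹ ≤ T₁) (hT2 : ∑ z, ((1 + δ₂ z) ^ a)⁻¹ ≤ T₂) :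
    ∑ z, ((1 + δ₁ z) ^ a)⁻¹ * ((1 + δ₂ z) ^ a)⁻¹ ≤ (2 : ℝ) ^ a * (T₁ + T₂) * ((1 + Dxy) ^ a)⁻¹ := by
  have h1 : ∀ z, 0 < 1 + δ₁ z := fun z => by linarith [hδ₁ z]
  have h2 : ∀ z, 0 < 1 + δ₂ z := fun z => by linarith [hδ₂ z]
  have hp1 : ∀ z, 0 ≤ ((1 + δ₁ z) ^ a)⁻¹ := fun z => inv_nonneg.2 (Real.rpow_nonneg (h1 z).le a)
  have hp2 : ∀ z, 0 ≤ ((1 + δ₂ z) ^ a)⁻¹ := fun z => inv_nonneg.2 (Real.rpow_nonneg (h2 z).le a)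
  have hf : ∀ z, |((1 + δ₁ z) ^ a)⁻¹| * (1 + δ₁ z) ^ a ≤ 1 := fun z => by
    rw [abs_of_nonneg (hp1 z), inv_mul_cancel₀ (Real.rpow_pos_of_pos (h1 z) a).ne']
  have hg : ∀ z, |((1 + δ₂ z) ^ a)⁻¹| * (1 + δ₂ z) ^ a ≤ 1 := fun z => by
    rw [abs_of_nonneg (hp2 z), inv_mul_cancel₀ (Real.rpow_pos_of_pos (h2 z) a).ne']
  have h := sum_mul_le_two_region_ext δ₁ δ₂ Dxy ha ha hD htri zero_le_one zero_le_one hf hg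
  simp only [abs_of_nonneg (hp1 _), abs_of_nonneg (hp2 _), mul_one] at h
  have hw : 0 ≤ ((1 + Dxy) ^ a)⁻¹ := inv_nonneg.2 (Real.rpow_nonneg (by linarith) a)
  have h2a : 0 ≤ (2 : ℝ) ^ a := Real.rpow_nonneg (by norm_num) a
  calc ∑ z, ((1 + δ₁ z) ^ a)⁻¹ * ((1 + δ₂ z) ^ a)⁻¹
        ≤ 2 ^ a * ((1 + Dxy) ^ a)⁻¹ * ∑ z, ((1 + δ₂ z) ^ a)⁻¹ + 2 ^ a * ((1 + Dxy) ^ a)⁻¹ * ∑ z, ((1 + δ₁ z) ^ a)⁻¹ := h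
    _ ≤ 2 ^ a * ((1 + Dxy) ^ a)⁻¹ * T₂ + 2 ^ a * ((1 + Dxy) ^ a)⁻¹ * T₁ :=
        add_le_add (mul_le_mul_of_nonneg_left hT2 (mul_nonneg h2a hw)) (mul_le_mul_of_nonneg_left hT1 (mul_nonneg h2a hw))
    _ = (2 : ℝ) ^ a * (T₁ + T₂) * ((1 + Dxy) ^ a)⁻¹ := by ring

end Conv

/-! ## Weighted sums against a decaying kernel -/

section Apply

variable {S : Type*} [Fintype S]

/-- `|Σ_z E z · f z| ≤ L·B·W` when `|E z|(1+δ₁ z)^a ≤ L`, `|f z|(1+δ₂ z)^b ≤ B` and `Σ_z (1+δ₁ z)^{−a}(1+δ₂ z)^{−b} ≤ W`. -/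
theorem abs_sum_mul_le_of_conv (δ₁ δ₂ : S → ℝ) {a b L B W : ℝ} (hL : 0 ≤ L) (hB : 0 ≤ B)
    (hδ₁ : ∀ z, 0 ≤ δ₁ z) (hδ₂ : ∀ z, 0 ≤ δ₂ z) (E f : S → ℝ)
    (hE : ∀ z, |E z| * (1 + δ₁ z) ^ a ≤ L) (hf : ∀ z, |f z| * (1 + δ₂ z) ^ b ≤ B)
    (hconv : ∑ z, ((1 + δ₁ z) ^ a)⁻¹ * ((1 + δ₂ z) ^ b)⁻¹ ≤ W) :
    |∑ z, E z * f z| ≤ L * B * W := by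
  have hterm : ∀ z, |E z * f z| ≤ L * B * (((1 + δ₁ z) ^ a)⁻¹ * ((1 + δ₂ z) ^ b)⁻¹) := by
    intro z
    have h1 : 0 < (1 + δ₁ z) ^ a := Real.rpow_pos_of_pos (by linarith [hδ₁ z]) _
    have h2 : 0 < (1 + δ₂ z) ^ b := Real.rpow_pos_of_pos (by linarith [hδ₂ z]) _
    have ha' : |E z| ≤ L * ((1 + δ₁ z) ^ a)⁻¹ := by rw [← div_eq_mul_inv, le_div_iff₀ h1]; exact hE z
    have hb' : |f z| ≤ B * ((1 + δ₂ z) ^ b)⁻¹ := by rw [← div_eq_mul_inv, le_div_iff₀ h2]; exact hf z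
    rw [abs_mul]
    calc |E z| * |f z| ≤ (L * ((1 + δ₁ z) ^ a)⁻¹) * (B * ((1 + δ₂ z) ^ b)⁻¹) := mul_le_mul ha' hb' (abs_nonneg _) (by positivity)
      _ = _ := by ring
  calc |∑ z, E z * f z| ≤ ∑ z, |E z * f z| := Finset.abs_sum_le_sum_abs _ _
    _ ≤ ∑ z, L * B * (((1 + δ₁ z) ^ a)⁻¹ * ((1 + δ₂ z) ^ b)⁻¹) := Finset.sum_le_sum fun z _ => hterm z
    _ = L * B * ∑ z, ((1 + δ₁ z) ^ a)⁻¹ * ((1 + δ₂ z) ^ b)⁻¹ := by rw [Finset.mul_sum]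
    _ ≤ L * B * W := mul_le_mul_of_nonneg_left hconv (mul_nonneg hL hB)

/-- From `|x| ≤ K·(1+D)^{−t}` to `|x|·(1+D)^t ≤ K` (`D ≥ 0`). -/
theorem mul_rpow_le_of_le_mul_inv {x K D t : ℝ} (hD : 0 ≤ D) (h : |x| ≤ K * ((1 + D) ^ t)⁻¹) : |x| * (1 + D) ^ t ≤ K := by
  have hw : 0 < (1 + D) ^ t := Real.rpow_pos_of_pos (by linarith) t
  rwa [← le_div_iff₀ hw, div_eq_mul_inv]

end Apply

/-! ## The gradient decay theorem (abstract U1b) -/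

/-- **Schur–Jaffard GRADIENT decay.**  In the setting of ✓`schur_jaffard_decay` (skin growth `D_S < 7/2`; (h2) `|KI Cᵀ|(1+d)³ ≤ c₂`; skin Schur
complement `A − C KI Cᵀ` coercive with `(1+d)⁴`-decay `≤ c₃`; no (h1)), a source `λ = (λ_S, λ_R)` anchored at `e₀` with `|λ_S s|(1+d(s,e₀))⁴ ≤ a₀`,
`|(KI λ_R) r|(1+d(r,e₀))³ ≤ a₁` (gradient-type rest response), `|(C KI λ_R) s|(1+d(s,e₀))⁴ ≤ a₂` (Hessian-type skin trace) has response
`|(Q⁻¹λ)(e)|·(1+d(e,e₀))³ ≤ C′` for ALL `e` (`Q = fromBlocks A C Cᵀ K`; `C′` depends only on the displayed constants; NO logarithm). -/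
theorem schur_jaffard_gradient_decay {DS cS c₂ c₃ m₀ a₀ a₁ a₂ : ℝ} (hDS : 0 < DS) (hDS' : DS < 7 / 2) (hcS : 0 < cS)
    (hc₂ : 0 ≤ c₂) (hc₃ : 0 ≤ c₃) (hm : 0 < m₀) (ha₀ : 0 ≤ a₀) (ha₁ : 0 ≤ a₁) (ha₂ : 0 ≤ a₂) :
    ∃ Cfin : ℝ, 0 ≤ Cfin ∧ ∀ {S R : Type u} [Fintype S] [DecidableEq S] [Fintype R] [DecidableEq R]
      (d : S ⊕ R → S ⊕ R → ℝ),
      (∀ x y, 0 ≤ d x y) → (∀ x, d x x = 0) → (∀ x y, d x y = d y x) → (∀ x y z, d x y ≤ d x z + d z y) →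
      (∀ (y : S ⊕ R) (ρ : ℝ), 0 ≤ ρ → ((Finset.univ.filter (fun s : S => d (Sum.inl s) y ≤ ρ)).card : ℝ) ≤ cS * (1 + ρ) ^ DS) →
      ∀ (A : Matrix S S ℝ) (C : Matrix S R ℝ) (K KI : Matrix R R ℝ), A.IsSymm → KI.IsSymm → K * KI = 1 →
        (∀ r s, |(KI * Cᵀ) r s| * (1 + d (Sum.inr r) (Sum.inl s)) ^ (3 : ℝ) ≤ c₂) →
        (∀ v : S → ℝ, m₀ * ∑ x, v x ^ 2 ≤ v ⬝ᵥ ((A - C * KI * Cᵀ) *ᵥ v)) →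
        (∀ s s', |(A - C * KI * Cᵀ) s s'| * (1 + d (Sum.inl s) (Sum.inl s')) ^ (4 : ℝ) ≤ c₃) →
        ∀ (lS : S → ℝ) (lR : R → ℝ) (e₀ : S ⊕ R),
          (∀ s, |lS s| * (1 + d (Sum.inl s) e₀) ^ (4 : ℝ) ≤ a₀) →
          (∀ r, |(KI *ᵥ lR) r| * (1 + d (Sum.inr r) e₀) ^ (3 : ℝ) ≤ a₁) →
          (∀ s, |(C *ᵥ (KI *ᵥ lR)) s| * (1 + d (Sum.inl s) e₀) ^ (4 : ℝ) ≤ a₂) →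
          ∀ e, |((Matrix.fromBlocks A C Cᵀ K)⁻¹ *ᵥ Sum.elim lS lR) e| * (1 + d e e₀) ^ (3 : ℝ) ≤ Cfin := by
  have h4 : DS < 4 := by linarith
  obtain ⟨CJ, hCJ0, hJ⟩ := inverse_decay_of_posDef_of_growth (r := 4) (D := DS) (cS := cS) (m₀ := m₀) (C := c₃) hDS h4 hcS hm hc₃
  set T₄ : ℝ := cS * (2 : ℝ) ^ DS * (1 - (2 : ℝ) ^ (DS - 4))⁻¹ with hT₄
  set T : ℝ := cS * (2 : ℝ) ^ DS * (1 - (2 : ℝ) ^ (DS - 7 / 2))⁻¹ with hT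
  have h2lt : ∀ t : ℝ, t < 0 → 0 ≤ (1 - (2 : ℝ) ^ t)⁻¹ := fun t ht =>
    inv_nonneg.2 (by linarith [Real.rpow_lt_one_of_one_lt_of_neg one_lt_two ht])
  have hT₄0 : 0 ≤ T₄ := by have := h2lt (DS - 4) (by linarith); positivity
  have hT0 : 0 ≤ T := by have := h2lt (DS - 7 / 2) (by linarith); positivity
  set W : ℝ := 8 * T₄ + 32 * T with hW
  have hW0 : 0 ≤ W := by positivity
  set L₁ : ℝ := c₂ * CJ * W with hL₁
  have hL₁0 : 0 ≤ L₁ := by positivity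
  set aw : ℝ := a₀ + a₂ with haw
  have haw0 : 0 ≤ aw := by positivity
  set B₁ : ℝ := CJ * aw * W with hB₁
  set B₂ : ℝ := L₁ * aw * W with hB₂
  refine ⟨a₁ + B₁ + B₂, by positivity, ?_⟩
  intro S R _ _ _ _ d hd0 hdd hdsymm htri hG A C K KI hA hKI hK h2 hcoer h3 lS lR e₀ hlS hKl hCKl
  -- the skin Schur complement and its inverse
  set M' : Matrix S S ℝ := A - C * KI * Cᵀ with hM'
  have hM'symm : M'.IsSymm := by
    rw [Matrix.IsSymm, hM', Matrix.transpose_sub, Matrix.transpose_mul, Matrix.transpose_mul, Matrix.transpose_transpose, hA.eq,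
      hKI.eq, Matrix.mul_assoc]
  have hdet : IsUnit M'.det := isUnit_det_of_coercive hm hcoer
  set MI : Matrix S S ℝ := M'⁻¹ with hMI
  have hMMI : M' * MI = 1 := Matrix.mul_nonsing_inv _ hdet
  have hMIsymm : MI.IsSymm := by
    rw [Matrix.IsSymm, hMI, Matrix.transpose_nonsing_inv, hM'symm.eq]
  -- Jaffard on the skin
  set dS : S → S → ℝ := fun s s' => d (Sum.inl s) (Sum.inl s') with hdS
  obtain ⟨hMIdec, -⟩ := hJ dS (fun x y => hd0 _ _) (fun x => hdd _) (fun x y => hdsymm _ _) (fun x y z => htri _ _ _)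
    (fun y ρ hρ => hG (Sum.inl y) ρ hρ) M' hM'symm hcoer h3
  -- row sums over the skin around any point
  have hrow : ∀ (y : S ⊕ R) (t : ℝ), DS < t → ∑ s : S, ((1 + d (Sum.inl s) y) ^ t)⁻¹ ≤ cS * (2 : ℝ) ^ DS * (1 - (2 : ℝ) ^ (DS - t))⁻¹ :=
    fun y t ht => sum_inv_rpow_le_of_growth_ext (fun s : S => d (Sum.inl s) y) hDS.le ht hcS.le (fun s => hd0 _ _) (fun ρ hρ => hG y ρ hρ)
  have hrow' : ∀ (y : S ⊕ R) (t : ℝ), DS < t → ∑ s : S, ((1 + d y (Sum.inl s)) ^ t)⁻¹ ≤ cS * (2 : ℝ) ^ DS * (1 - (2 : ℝ) ^ (DS - t))⁻¹ := by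
    intro y t ht
    have h := hrow y t ht
    rwa [show (fun s : S => ((1 + d (Sum.inl s) y) ^ t)⁻¹) = fun s => ((1 + d y (Sum.inl s)) ^ t)⁻¹ from
      funext fun s => by rw [hdsymm]] at h
  -- the block inverse
  set G : Matrix (S ⊕ R) (S ⊕ R) ℝ :=
    Matrix.fromBlocks MI (-(MI * C * KI)) (-(KI * Cᵀ * MI)) (KI + KI * Cᵀ * MI * C * KI) with hGdef
  have hQG : Matrix.fromBlocks A C Cᵀ K * G = 1 := fromBlocks_mul_schurInverse A C K KI MI hK hMMI
  have hinv : (Matrix.fromBlocks A C Cᵀ K)⁻¹ = G := Matrix.inv_eq_right_inv hQG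
  rw [hinv]
  -- weight comparison
  have hwle : ∀ (x y : S ⊕ R) (t t' : ℝ), t ≤ t' → (1 + d x y) ^ t ≤ (1 + d x y) ^ t' := fun x y t t' ht =>
    Real.rpow_le_rpow_of_exponent_le (by linarith [hd0 x y]) ht
  -- the mixed kernel `E = KI Cᵀ MI` decays like `(1+d)^{-3}` (as in `schur_jaffard_decay`)
  have hE : ∀ (r : R) (s : S), |(KI * Cᵀ * MI) r s| * (1 + d (Sum.inr r) (Sum.inl s)) ^ (3 : ℝ) ≤ L₁ := by
    intro r s
    rw [Matrix.mul_apply]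
    have hconv := conv_three_four_le (S := S) (fun s' => d (Sum.inr r) (Sum.inl s')) (fun s' => d (Sum.inl s') (Sum.inl s))
      (d (Sum.inr r) (Sum.inl s)) (fun s' => hd0 _ _) (fun s' => hd0 _ _) (hd0 _ _) (fun s' => htri _ _ _)
      (T₄ := T₄) (T := T) (hrow (Sum.inl s) 4 h4) (hrow' (Sum.inr r) (7 / 2) hDS') (hrow (Sum.inl s) (7 / 2) hDS')
    have h := abs_sum_mul_le_of_conv _ _ hc₂ hCJ0 (fun s' => hd0 _ _) (fun s' => hd0 _ _)
      (fun s' => (KI * Cᵀ) r s') (fun s' => MI s' s) (fun s' => h2 r s') (fun s' => hMIdec s' s) hconv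
    refine mul_rpow_le_of_le_mul_inv (hd0 _ _) (h.trans (le_of_eq ?_))
    rw [hL₁]; ring
  -- the effective skin source `w = λ_S − C KI λ_R`
  set w : S → ℝ := lS - C *ᵥ (KI *ᵥ lR) with hw
  have hwdec : ∀ s, |w s| * (1 + d (Sum.inl s) e₀) ^ (4 : ℝ) ≤ aw := by
    intro s
    rw [hw, Pi.sub_apply]
    have hwt : 0 ≤ (1 + d (Sum.inl s) e₀) ^ (4 : ℝ) := Real.rpow_nonneg (by linarith [hd0 (Sum.inl s) e₀]) _
    calc |lS s - (C *ᵥ (KI *ᵥ lR)) s| * (1 + d (Sum.inl s) e₀) ^ (4 : ℝ)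
          ≤ (|lS s| + |(C *ᵥ (KI *ᵥ lR)) s|) * (1 + d (Sum.inl s) e₀) ^ (4 : ℝ) := mul_le_mul_of_nonneg_right (abs_sub _ _) hwt
      _ ≤ a₀ + a₂ := by rw [add_mul]; exact add_le_add (hlS s) (hCKl s)
  -- `MI w` decays like `(1+d(·,e₀))^{-3}`
  have hMIw : ∀ s, |(MI *ᵥ w) s| * (1 + d (Sum.inl s) e₀) ^ (3 : ℝ) ≤ B₁ := by
    intro s
    have hconv := conv_three_four_le (S := S) (fun z => d (Sum.inl s) (Sum.inl z)) (fun z => d (Sum.inl z) e₀)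
      (d (Sum.inl s) e₀) (fun z => hd0 _ _) (fun z => hd0 _ _) (hd0 _ _) (fun z => htri _ _ _)
      (T₄ := T₄) (T := T) (hrow e₀ 4 h4) (hrow' (Sum.inl s) (7 / 2) hDS') (hrow e₀ (7 / 2) hDS')
    have hker : ∀ z, |MI s z| * (1 + d (Sum.inl s) (Sum.inl z)) ^ (3 : ℝ) ≤ CJ := fun z =>
      (mul_le_mul_of_nonneg_left (hwle _ _ 3 4 (by norm_num)) (abs_nonneg _)).trans (hMIdec s z)
    have h := abs_sum_mul_le_of_conv _ _ hCJ0 haw0 (fun z => hd0 _ _) (fun z => hd0 _ _)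
      (fun z => MI s z) w hker hwdec hconv
    refine mul_rpow_le_of_le_mul_inv (hd0 _ _) ?_
    rw [Matrix.mulVec, dotProduct]
    refine h.trans (le_of_eq ?_)
    rw [hB₁]; ring
  -- `E w` decays like `(1+d(·,e₀))^{-3}`
  have hEw : ∀ r, |((KI * Cᵀ * MI) *ᵥ w) r| * (1 + d (Sum.inr r) e₀) ^ (3 : ℝ) ≤ B₂ := by
    intro r
    have hconv := conv_three_four_le (S := S) (fun z => d (Sum.inr r) (Sum.inl z)) (fun z => d (Sum.inl z) e₀)
      (d (Sum.inr r) e₀) (fun z => hd0 _ _) (fun z => hd0 _ _) (hd0 _ _) (fun z => htri _ _ _)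
      (T₄ := T₄) (T := T) (hrow e₀ 4 h4) (hrow' (Sum.inr r) (7 / 2) hDS') (hrow e₀ (7 / 2) hDS')
    have h := abs_sum_mul_le_of_conv _ _ hL₁0 haw0 (fun z => hd0 _ _) (fun z => hd0 _ _)
      (fun z => (KI * Cᵀ * MI) r z) w (fun z => hE r z) hwdec hconv
    refine mul_rpow_le_of_le_mul_inv (hd0 _ _) ?_
    rw [Matrix.mulVec, dotProduct]
    refine h.trans (le_of_eq ?_)
    rw [hB₂]; ring
  have hB₁0 : 0 ≤ B₁ := by positivity
  have hB₂0 : 0 ≤ B₂ := by positivity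
  intro e
  rcases e with s | r
  · rw [hGdef, schurInverse_mulVec_inl]
    calc |(MI *ᵥ w) s| * (1 + d (Sum.inl s) e₀) ^ (3 : ℝ) ≤ B₁ := hMIw s
      _ ≤ a₁ + B₁ + B₂ := by linarith
  · rw [hGdef, schurInverse_mulVec_inr]
    have hwt : 0 ≤ (1 + d (Sum.inr r) e₀) ^ (3 : ℝ) := Real.rpow_nonneg (by linarith [hd0 (Sum.inr r) e₀]) _
    calc |(KI *ᵥ lR) r - ((KI * Cᵀ * MI) *ᵥ w) r| * (1 + d (Sum.inr r) e₀) ^ (3 : ℝ)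
          ≤ (|(KI *ᵥ lR) r| + |((KI * Cᵀ * MI) *ᵥ w) r|) * (1 + d (Sum.inr r) e₀) ^ (3 : ℝ) :=
          mul_le_mul_of_nonneg_right (abs_sub _ _) hwt
      _ ≤ a₁ + B₂ := by rw [add_mul]; exact add_le_add (hKl r) (hEw r)
      _ ≤ a₁ + B₁ + B₂ := by linarith

/-! ## The dipole decay theorem (abstract U1c) -/

/-- **Schur–Jaffard DIPOLE decay (skin correction).**  With skin growth `D_S < 4`, `A − C KI Cᵀ` coercive with `(1+d)⁴`-decay, and two sources
`λ, λ′` anchored at `e₀, e₀′` with `|λ_S|, |C KI λ_R| ≲ (1+d(·,e₀))^{−4}` (resp. `e₀′`): `|λᵀ Q⁻¹ λ′ − λ_Rᵀ KI λ′_R|·(1+d(e₀,e₀′))⁴ ≤ C″` — the dipole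
kernel is the rest dipole kernel (a mixed Hessian of the rest Green function) plus a skin correction with the SAME decay; no (h1)/(h2), no log. -/
theorem schur_jaffard_dipole_decay {DS cS c₃ m₀ a₀ a₂ : ℝ} (hDS : 0 < DS) (hDS4 : DS < 4) (hcS : 0 < cS)
    (hc₃ : 0 ≤ c₃) (hm : 0 < m₀) (ha₀ : 0 ≤ a₀) (ha₂ : 0 ≤ a₂) :
    ∃ Cfin : ℝ, 0 ≤ Cfin ∧ ∀ {S R : Type u} [Fintype S] [DecidableEq S] [Fintype R] [DecidableEq R]
      (d : S ⊕ R → S ⊕ R → ℝ),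
      (∀ x y, 0 ≤ d x y) → (∀ x, d x x = 0) → (∀ x y, d x y = d y x) → (∀ x y z, d x y ≤ d x z + d z y) →
      (∀ (y : S ⊕ R) (ρ : ℝ), 0 ≤ ρ → ((Finset.univ.filter (fun s : S => d (Sum.inl s) y ≤ ρ)).card : ℝ) ≤ cS * (1 + ρ) ^ DS) →
      ∀ (A : Matrix S S ℝ) (C : Matrix S R ℝ) (K KI : Matrix R R ℝ), A.IsSymm → KI.IsSymm → K * KI = 1 →
        (∀ v : S → ℝ, m₀ * ∑ x, v x ^ 2 ≤ v ⬝ᵥ ((A - C * KI * Cᵀ) *ᵥ v)) →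
        (∀ s s', |(A - C * KI * Cᵀ) s s'| * (1 + d (Sum.inl s) (Sum.inl s')) ^ (4 : ℝ) ≤ c₃) →
        ∀ (lS lS' : S → ℝ) (lR lR' : R → ℝ) (e₀ e₀' : S ⊕ R),
          (∀ s, |lS s| * (1 + d (Sum.inl s) e₀) ^ (4 : ℝ) ≤ a₀) →
          (∀ s, |(C *ᵥ (KI *ᵥ lR)) s| * (1 + d (Sum.inl s) e₀) ^ (4 : ℝ) ≤ a₂) →
          (∀ s, |lS' s| * (1 + d (Sum.inl s) e₀') ^ (4 : ℝ) ≤ a₀) →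
          (∀ s, |(C *ᵥ (KI *ᵥ lR')) s| * (1 + d (Sum.inl s) e₀') ^ (4 : ℝ) ≤ a₂) →
          |Sum.elim lS lR ⬝ᵥ ((Matrix.fromBlocks A C Cᵀ K)⁻¹ *ᵥ Sum.elim lS' lR') - lR ⬝ᵥ (KI *ᵥ lR')| *
              (1 + d e₀ e₀') ^ (4 : ℝ) ≤ Cfin := by
  obtain ⟨CJ, hCJ0, hJ⟩ := inverse_decay_of_posDef_of_growth (r := 4) (D := DS) (cS := cS) (m₀ := m₀) (C := c₃) hDS hDS4 hcS hm hc₃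
  set T₄ : ℝ := cS * (2 : ℝ) ^ DS * (1 - (2 : ℝ) ^ (DS - 4))⁻¹ with hT₄
  have hT₄0 : 0 ≤ T₄ := by
    have : 0 ≤ (1 - (2 : ℝ) ^ (DS - 4))⁻¹ :=
      inv_nonneg.2 (by linarith [Real.rpow_lt_one_of_one_lt_of_neg one_lt_two (show DS - 4 < 0 by linarith)])
    positivity
  set W : ℝ := (2 : ℝ) ^ (4 : ℝ) * (T₄ + T₄) with hW
  have hW0 : 0 ≤ W := by positivity
  set aw : ℝ := a₀ + a₂ with haw
  have haw0 : 0 ≤ aw := by positivity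
  set B₃ : ℝ := CJ * aw * W with hB₃
  have hB₃0 : 0 ≤ B₃ := by positivity
  refine ⟨aw * B₃ * W, by positivity, ?_⟩
  intro S R _ _ _ _ d hd0 hdd hdsymm htri hG A C K KI hA hKI hK hcoer h3 lS lS' lR lR' e₀ e₀' hlS hCKl hlS' hCKl'
  set M' : Matrix S S ℝ := A - C * KI * Cᵀ with hM'
  have hM'symm : M'.IsSymm := by
    rw [Matrix.IsSymm, hM', Matrix.transpose_sub, Matrix.transpose_mul, Matrix.transpose_mul, Matrix.transpose_transpose, hA.eq,
      hKI.eq, Matrix.mul_assoc]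
  have hdet : IsUnit M'.det := isUnit_det_of_coercive hm hcoer
  set MI : Matrix S S ℝ := M'⁻¹ with hMI
  have hMMI : M' * MI = 1 := Matrix.mul_nonsing_inv _ hdet
  have hMIsymm : MI.IsSymm := by
    rw [Matrix.IsSymm, hMI, Matrix.transpose_nonsing_inv, hM'symm.eq]
  set dS : S → S → ℝ := fun s s' => d (Sum.inl s) (Sum.inl s') with hdS
  obtain ⟨hMIdec, -⟩ := hJ dS (fun x y => hd0 _ _) (fun x => hdd _) (fun x y => hdsymm _ _) (fun x y z => htri _ _ _)
    (fun y ρ hρ => hG (Sum.inl y) ρ hρ) M' hM'symm hcoer h3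
  have hrow : ∀ y : S ⊕ R, ∑ s : S, ((1 + d (Sum.inl s) y) ^ (4 : ℝ))⁻¹ ≤ T₄ :=
    fun y => sum_inv_rpow_le_of_growth_ext (fun s : S => d (Sum.inl s) y) hDS.le hDS4 hcS.le (fun s => hd0 _ _) (fun ρ hρ => hG y ρ hρ)
  have hrow' : ∀ y : S ⊕ R, ∑ s : S, ((1 + d y (Sum.inl s)) ^ (4 : ℝ))⁻¹ ≤ T₄ := by
    intro y
    have h := hrow y
    rwa [show (fun s : S => ((1 + d (Sum.inl s) y) ^ (4 : ℝ))⁻¹) = fun s => ((1 + d y (Sum.inl s)) ^ (4 : ℝ))⁻¹ from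
      funext fun s => by rw [hdsymm]] at h
  -- the block inverse and the bilinear identity
  set G : Matrix (S ⊕ R) (S ⊕ R) ℝ :=
    Matrix.fromBlocks MI (-(MI * C * KI)) (-(KI * Cᵀ * MI)) (KI + KI * Cᵀ * MI * C * KI) with hGdef
  have hQG : Matrix.fromBlocks A C Cᵀ K * G = 1 := fromBlocks_mul_schurInverse A C K KI MI hK hMMI
  have hinv : (Matrix.fromBlocks A C Cᵀ K)⁻¹ = G := Matrix.inv_eq_right_inv hQG
  rw [hinv, hGdef, sumElim_dotProduct_schurInverse_mulVec C KI MI hKI hMIsymm, add_sub_cancel_left]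
  -- the two effective skin sources
  set w : S → ℝ := lS - C *ᵥ (KI *ᵥ lR) with hw
  set w' : S → ℝ := lS' - C *ᵥ (KI *ᵥ lR') with hw'
  have hwdec : ∀ s, |w s| * (1 + d e₀ (Sum.inl s)) ^ (4 : ℝ) ≤ aw := by
    intro s
    rw [hw, Pi.sub_apply, hdsymm]
    have hwt : 0 ≤ (1 + d (Sum.inl s) e₀) ^ (4 : ℝ) := Real.rpow_nonneg (by linarith [hd0 (Sum.inl s) e₀]) _
    calc |lS s - (C *ᵥ (KI *ᵥ lR)) s| * (1 + d (Sum.inl s) e₀) ^ (4 : ℝ)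
          ≤ (|lS s| + |(C *ᵥ (KI *ᵥ lR)) s|) * (1 + d (Sum.inl s) e₀) ^ (4 : ℝ) := mul_le_mul_of_nonneg_right (abs_sub _ _) hwt
      _ ≤ a₀ + a₂ := by rw [add_mul]; exact add_le_add (hlS s) (hCKl s)
  have hw'dec : ∀ s, |w' s| * (1 + d (Sum.inl s) e₀') ^ (4 : ℝ) ≤ aw := by
    intro s
    rw [hw', Pi.sub_apply]
    have hwt : 0 ≤ (1 + d (Sum.inl s) e₀') ^ (4 : ℝ) := Real.rpow_nonneg (by linarith [hd0 (Sum.inl s) e₀']) _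
    calc |lS' s - (C *ᵥ (KI *ᵥ lR')) s| * (1 + d (Sum.inl s) e₀') ^ (4 : ℝ)
          ≤ (|lS' s| + |(C *ᵥ (KI *ᵥ lR')) s|) * (1 + d (Sum.inl s) e₀') ^ (4 : ℝ) := mul_le_mul_of_nonneg_right (abs_sub _ _) hwt
      _ ≤ a₀ + a₂ := by rw [add_mul]; exact add_le_add (hlS' s) (hCKl' s)
  -- `MI w′` decays like `(1+d(·,e₀′))^{-4}`
  have hMIw' : ∀ s, |(MI *ᵥ w') s| * (1 + d (Sum.inl s) e₀') ^ (4 : ℝ) ≤ B₃ := by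
    intro s
    have hconv := conv_same_le (S := S) (fun z => d (Sum.inl s) (Sum.inl z)) (fun z => d (Sum.inl z) e₀') (d (Sum.inl s) e₀')
      (a := 4) (by norm_num) (fun z => hd0 _ _) (fun z => hd0 _ _) (hd0 _ _) (fun z => htri _ _ _) (hrow' (Sum.inl s)) (hrow e₀')
    have h := abs_sum_mul_le_of_conv _ _ hCJ0 haw0 (fun z => hd0 _ _) (fun z => hd0 _ _)
      (fun z => MI s z) w' (fun z => hMIdec s z) hw'dec hconv
    refine mul_rpow_le_of_le_mul_inv (hd0 _ _) ?_
    rw [Matrix.mulVec, dotProduct]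
    refine h.trans (le_of_eq ?_)
    rw [hB₃]; ring
  have hconv := conv_same_le (S := S) (fun z => d e₀ (Sum.inl z)) (fun z => d (Sum.inl z) e₀') (d e₀ e₀')
    (a := 4) (by norm_num) (fun z => hd0 _ _) (fun z => hd0 _ _) (hd0 _ _) (fun z => htri _ _ _) (hrow' e₀) (hrow e₀')
  have h := abs_sum_mul_le_of_conv _ _ haw0 hB₃0 (fun z => hd0 _ _) (fun z => hd0 _ _) w (MI *ᵥ w') hwdec hMIw' hconv
  refine mul_rpow_le_of_le_mul_inv (hd0 _ _) ?_
  rw [dotProduct]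
  exact h.trans (le_of_eq (by ring))

/-- **Schur–Jaffard DIPOLE decay, packaged**: adding the rest dipole bound `|λ_Rᵀ KI λ′_R|·(1+d(e₀,e₀′))⁴ ≤ a₃` gives
`|λᵀ Q⁻¹ λ′|·(1+d(e₀,e₀′))⁴ ≤ C″ + a₃`. -/
theorem schur_jaffard_dipole_decay' {DS cS c₃ m₀ a₀ a₂ : ℝ} (hDS : 0 < DS) (hDS4 : DS < 4) (hcS : 0 < cS)
    (hc₃ : 0 ≤ c₃) (hm : 0 < m₀) (ha₀ : 0 ≤ a₀) (ha₂ : 0 ≤ a₂) :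
    ∃ Cfin : ℝ, 0 ≤ Cfin ∧ ∀ {S R : Type u} [Fintype S] [DecidableEq S] [Fintype R] [DecidableEq R]
      (d : S ⊕ R → S ⊕ R → ℝ),
      (∀ x y, 0 ≤ d x y) → (∀ x, d x x = 0) → (∀ x y, d x y = d y x) → (∀ x y z, d x y ≤ d x z + d z y) →
      (∀ (y : S ⊕ R) (ρ : ℝ), 0 ≤ ρ → ((Finset.univ.filter (fun s : S => d (Sum.inl s) y ≤ ρ)).card : ℝ) ≤ cS * (1 + ρ) ^ DS) →
      ∀ (A : Matrix S S ℝ) (C : Matrix S R ℝ) (K KI : Matrix R R ℝ), A.IsSymm → KI.IsSymm → K * KI = 1 →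
        (∀ v : S → ℝ, m₀ * ∑ x, v x ^ 2 ≤ v ⬝ᵥ ((A - C * KI * Cᵀ) *ᵥ v)) →
        (∀ s s', |(A - C * KI * Cᵀ) s s'| * (1 + d (Sum.inl s) (Sum.inl s')) ^ (4 : ℝ) ≤ c₃) →
        ∀ (lS lS' : S → ℝ) (lR lR' : R → ℝ) (e₀ e₀' : S ⊕ R) (a₃ : ℝ),
          (∀ s, |lS s| * (1 + d (Sum.inl s) e₀) ^ (4 : ℝ) ≤ a₀) →
          (∀ s, |(C *ᵥ (KI *ᵥ lR)) s| * (1 + d (Sum.inl s) e₀) ^ (4 : ℝ) ≤ a₂) →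
          (∀ s, |lS' s| * (1 + d (Sum.inl s) e₀') ^ (4 : ℝ) ≤ a₀) →
          (∀ s, |(C *ᵥ (KI *ᵥ lR')) s| * (1 + d (Sum.inl s) e₀') ^ (4 : ℝ) ≤ a₂) →
          |lR ⬝ᵥ (KI *ᵥ lR')| * (1 + d e₀ e₀') ^ (4 : ℝ) ≤ a₃ →
          |Sum.elim lS lR ⬝ᵥ ((Matrix.fromBlocks A C Cᵀ K)⁻¹ *ᵥ Sum.elim lS' lR')| * (1 + d e₀ e₀') ^ (4 : ℝ) ≤ Cfin + a₃ := by
  obtain ⟨Cfin, hC0, h⟩ := schur_jaffard_dipole_decay (a₀ := a₀) (a₂ := a₂) hDS hDS4 hcS hc₃ hm ha₀ ha₂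
  refine ⟨Cfin, hC0, ?_⟩
  intro S R _ _ _ _ d hd0 hdd hdsymm htri hG A C K KI hA hKI hK hcoer h3 lS lS' lR lR' e₀ e₀' a₃ hlS hCKl hlS' hCKl' ha₃
  have hmain := h d hd0 hdd hdsymm htri hG A C K KI hA hKI hK hcoer h3 lS lS' lR lR' e₀ e₀' hlS hCKl hlS' hCKl'
  have hwt : 0 ≤ (1 + d e₀ e₀') ^ (4 : ℝ) := Real.rpow_nonneg (by linarith [hd0 e₀ e₀']) _
  set x := Sum.elim lS lR ⬝ᵥ ((Matrix.fromBlocks A C Cᵀ K)⁻¹ *ᵥ Sum.elim lS' lR')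
  set y := lR ⬝ᵥ (KI *ᵥ lR')
  calc |x| * (1 + d e₀ e₀') ^ (4 : ℝ) ≤ (|x - y| + |y|) * (1 + d e₀ e₀') ^ (4 : ℝ) :=
        mul_le_mul_of_nonneg_right (by have := abs_add_le (x - y) y; rwa [sub_add_cancel] at this) hwt
    _ ≤ Cfin + a₃ := by rw [add_mul]; exact add_le_add hmain ha₃


end Summit.QuantumFields.YangMills.Theorems.AllWindowsColdBox.Jaffard
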